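import Summits.AtomisticToContinuum.Crystallization.Theorems.OverbindingBudgetAffineFarFieldCollarWindow
import Summits.AtomisticToContinuum.Crystallization.Theorems.OverbindingBudgetAffineFarFieldCellVoronoiFeed

/-!
# Overbinding budget, affine far field — «LedgerTiling»: the two tessellations of the window for the far-field ledger

Support file for `Summit.AtomisticToContinuum.Crystallization.Theses.OverbindingBudget.RobustDefectLimitWindows`
(sub-problem (2c), leaf SW♭(30), part 27V «Voronoi-cell quadrature of the far field», instance 27Vc, density + ledger side).
The far-field ledger («CellLedgerIdeal» `farField_ledger_ideal`, instantiated in «LedgerWindow»/«LedgerShells») takes the two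
TESSELLATIONS OF THE WINDOW as eight hypotheses: for the movers `t` (actual Voronoi cells `voronoiCell W (ych i)`,
`W = windowAtomSet Ach ych yunc`) and for the reference sites `uref` (reference cells `refCell j`) a remainder set `Ucᵢ` that is
null-measurable, a.e.-disjoint from the cell union, completes it to the same window `Wr` a.e., and carries `g` integrably.
This file DISCHARGES them with the convention of record (POINTERS-g98 §3 (α)):

* `Wr := univ`;
* `Uc₁ := moverRest … t` = «CollarWindow» `collarActCore` (actual cells of the charted core sites and of all uncharted atoms)
  ∪ the actual cells of the charted non-core sites NOT in `t` (the outer HALO of the window);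
* `Uc₂ := refRest … uref` = `collarRefCore` ∪ the reference cells of the non-core sites not in `uref`.

Facts: the covers are EXACT (`cover_moverRest` from «CollarWindow» `iUnion_actCellI`: finitely many atoms, one charted;
`cover_refRest` from «CollarSites» `iUnion_voronoiCell_placedSite`); measurability (closed cells, countable unions);
a.e.-disjointness from «CellVoronoiFeed» `aedisjoint_voronoiCell` (distinct atoms: `ych` injective on `Ach` — registration
`2û < ν` gives it — and movers distinct from uncharted atoms; distinct sites: `placedSite_injective`); integrability from
`Integrable g` (the window's kernel `g = χ·f` is continuous with compact support).

THE HALO CARRIES NO `g`: `∫_{Uc₁} g = ∫_{collarActCore} g` and `∫_{Uc₂} g = ∫_{collarRefCore} g` (`integral_moverRest_eq`,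
`integral_refRest_eq`) as soon as `g` vanishes on the halo cells; `halo_zero_ref` reads that off `supp g ⊆ closedBall q₀ ρg` and
`ρg + r₀ < dist (p u) q₀` for reference halo sites (circumradius `r₀ = ν/√2`); `halo_zero_act` reads it off the same support
row, the CHARTED ANNULUS `ρ₁ < dist (p u) q₀ ≤ ρg + r₀ ⇒ u ∈ Ach ∧ dist (ych u) (p u) ≤ û` (so every point of the annulus
`ρ₁ + r₀ < dist x q₀ ≤ ρg` has an atom within `r₀ + û`, `covering_of_charted`), ONE atom `z₀` within `R₀` of `q₀` (for the
points inside `ρ₁ + r₀`), and two halo inequalities `ρg + r₀ + û < dist (ych u) q₀`, `2(ρ₁ + r₀) + R₀ < dist (ych u) q₀`.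
With these the ledger's remainder term `√2/ν³ (∫_{Uc₂} g − ∫_{Uc₁} g)` is EXACTLY the interface term bounded by «CollarWindow»
`interfaceRow_window`.  ★ `tiling_window` packages the eight facts in the binder shapes of the ledger.  No local notation.

[this file]
-/

namespace Summit.AtomisticToContinuum.Crystallization.Theorems.OverbindingBudgetAffineFarFieldLedgerTiling

noncomputable section

open Set MeasureTheory Metric
open Literature.MathematicalPhysics.StatisticalMechanics (IsHaggSeq)
open Literature.Barriers.AtomisticToContinuum (voronoiCell isClosed_voronoiCell)
open Summit.AtomisticToContinuum.Crystallization.Theorems.OverbindingBudgetAffineFarFieldCellVoronoiFeed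
open Summit.AtomisticToContinuum.Crystallization.Theorems.OverbindingBudgetAffineFarFieldCollarSites
open Summit.AtomisticToContinuum.Crystallization.Theorems.OverbindingBudgetAffineFarFieldCollarWindow

/-! ## §1 The two remainder sets -/
section Objects

variable {μ : Type*} (s : ℤ → ℤ) (ν : ℝ) (q : EuclideanSpace ℝ (Fin 3))
  (R : EuclideanSpace ℝ (Fin 3) ≃ₗᵢ[ℝ] EuclideanSpace ℝ (Fin 3)) (Ach : Set (ℤ × ℤ × ℤ))
  (ych : ℤ × ℤ × ℤ → EuclideanSpace ℝ (Fin 3)) (yunc : μ → EuclideanSpace ℝ (Fin 3)) (q₀ : EuclideanSpace ℝ (Fin 3)) (r_c : ℝ)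

/-- The mover-side remainder `Uc₁`: the actual core union and the actual cells of the charted non-core sites off `t`. -/
def moverRest (t : Finset (ℤ × ℤ × ℤ)) : Set (EuclideanSpace ℝ (Fin 3)) :=
  collarActCore s ν q R Ach ych yunc q₀ r_c ∪
    ⋃ u ∈ (Ach \ collarCoreSites s ν q R q₀ r_c) \ ↑t, voronoiCell (windowAtomSet Ach ych yunc) (ych u)

/-- The reference-side remainder `Uc₂`: the reference core union and the reference cells of the non-core sites off `uref`. -/
def refRest (uref : Finset (ℤ × ℤ × ℤ)) : Set (EuclideanSpace ℝ (Fin 3)) :=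
  collarRefCore s ν q R q₀ r_c ∪ ⋃ u ∈ (collarCoreSites s ν q R q₀ r_c ∪ ↑uref)ᶜ, refCell s ν q R u

end Objects

section Facts

variable {μ : Type*} {s : ℤ → ℤ} {ν : ℝ} {q : EuclideanSpace ℝ (Fin 3)}
  {R : EuclideanSpace ℝ (Fin 3) ≃ₗᵢ[ℝ] EuclideanSpace ℝ (Fin 3)} {Ach : Set (ℤ × ℤ × ℤ)}
  {ych : ℤ × ℤ × ℤ → EuclideanSpace ℝ (Fin 3)} {yunc : μ → EuclideanSpace ℝ (Fin 3)} {q₀ : EuclideanSpace ℝ (Fin 3)} {r_c : ℝ}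

/-! ## §2 The mover side -/

/-- support (EXACT COVER, mover side): finitely many atoms, at least one charted ⇒ the mover cells and `moverRest` cover space.
[«CollarWindow» `iUnion_actCellI`] -/
theorem cover_moverRest [Finite μ] (hA : Ach.Finite) (hne : Ach.Nonempty) (t : Finset (ℤ × ℤ × ℤ)) :
    (⋃ i ∈ t, voronoiCell (windowAtomSet Ach ych yunc) (ych i)) ∪ moverRest s ν q R Ach ych yunc q₀ r_c t = univ := by
  refine eq_univ_of_forall fun x => ?_
  have hx : x ∈ ⋃ i, actCellI Ach ych yunc i := by rw [iUnion_actCellI (yunc := yunc) hA hne]; exact mem_univ x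
  obtain ⟨i, hi⟩ := mem_iUnion.1 hx
  rcases i with u | e
  · obtain ⟨hu, hxu⟩ := hi
    by_cases hc : u ∈ collarCoreSites s ν q R q₀ r_c
    · refine mem_union_right _ (mem_union_left _ (mem_union_left _ ?_))
      exact mem_biUnion (show u ∈ collarCoreSites s ν q R q₀ r_c ∩ Ach from ⟨hc, hu⟩) hxu
    by_cases hut : u ∈ t
    · exact mem_union_left _ (mem_biUnion hut hxu)
    · refine mem_union_right _ (mem_union_right _ ?_)
      exact mem_biUnion (show u ∈ (Ach \ collarCoreSites s ν q R q₀ r_c) \ ↑t from ⟨⟨hu, hc⟩, hut⟩) hxu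
  · exact mem_union_right _ (mem_union_left _ (mem_union_right _ (mem_iUnion.2 ⟨e, hi⟩)))

/-- support: `moverRest` is measurable (`Ach` finite, `μ` countable). [«CollarWindow» `measurableSet_collarActCore`] -/
theorem measurableSet_moverRest [Countable μ] (hA : Ach.Finite) (t : Finset (ℤ × ℤ × ℤ)) :
    MeasurableSet (moverRest s ν q R Ach ych yunc q₀ r_c t) :=
  (measurableSet_collarActCore hA).union
    (MeasurableSet.biUnion (to_countable _) fun _ _ => (isClosed_voronoiCell _ _).measurableSet)

/-- support (A.E.-DISJOINTNESS, mover side): movers are charted non-core sites, `ych` is injective on `Ach`, and no mover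
atom coincides with an uncharted atom ⇒ the mover cells are a.e.-disjoint from `moverRest`. [«CellVoronoiFeed»
`aedisjoint_voronoiCell`] -/
theorem aedisjoint_moverRest [Countable μ] (hinj : InjOn ych Ach) {t : Finset (ℤ × ℤ × ℤ)}
    (ht : ∀ u ∈ t, u ∈ Ach ∧ u ∉ collarCoreSites s ν q R q₀ r_c) (hsep : ∀ u ∈ t, ∀ e, ych u ≠ yunc e) :
    AEDisjoint volume (⋃ i ∈ t, voronoiCell (windowAtomSet Ach ych yunc) (ych i))
      (moverRest s ν q R Ach ych yunc q₀ r_c t) := by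
  have hW : ∀ u ∈ Ach, ych u ∈ windowAtomSet Ach ych yunc := fun u hu => mem_union_left _ (mem_image_of_mem ych hu)
  have hWe : ∀ e, yunc e ∈ windowAtomSet Ach ych yunc := fun e => mem_union_right _ (mem_range_self e)
  simp only [moverRest, collarActCore, AEDisjoint.iUnion_left_iff, AEDisjoint.union_right_iff,
    AEDisjoint.iUnion_right_iff]
  refine ⟨⟨fun u hu i hi => ?_, fun e i hi => ?_⟩, fun u hu i hi => ?_⟩
  · exact aedisjoint_voronoiCell (hW i (ht i hi).1) (hW u hu.2) fun h => (ht i hi).2 (by rw [hinj (ht i hi).1 hu.2 h]; exact hu.1)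
  · exact aedisjoint_voronoiCell (hW i (ht i hi).1) (hWe e) (hsep i hi e)
  · exact aedisjoint_voronoiCell (hW i (ht i hi).1) (hW u hu.1.1) fun h => hu.2 (by rwa [← hinj (ht i hi).1 hu.1.1 h])

/-- support: the halo carries no `g` ⇒ `∫_{moverRest} g = ∫_{collarActCore} g`. [Mathlib `integral_union_eq_left_of_forall`] -/
theorem integral_moverRest_eq {t : Finset (ℤ × ℤ × ℤ)} {g : EuclideanSpace ℝ (Fin 3) → ℝ}
    (hg0 : ∀ u ∈ Ach, u ∉ collarCoreSites s ν q R q₀ r_c → u ∉ t →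
      ∀ x ∈ voronoiCell (windowAtomSet Ach ych yunc) (ych u), g x = 0) :
    ∫ x in moverRest s ν q R Ach ych yunc q₀ r_c t, g x = ∫ x in collarActCore s ν q R Ach ych yunc q₀ r_c, g x := by
  refine integral_union_eq_left_of_forall
    (MeasurableSet.biUnion (to_countable _) fun _ _ => (isClosed_voronoiCell _ _).measurableSet) fun x hx => ?_
  obtain ⟨u, hu, hxu⟩ := mem_iUnion₂.1 hx
  exact hg0 u hu.1.1 hu.1.2 hu.2 x hxu

/-! ## §3 The reference side -/

/-- support (EXACT COVER, reference side). [«CollarSites» `iUnion_voronoiCell_placedSite`] -/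
theorem cover_refRest (hs : IsHaggSeq s) (hν : 0 < ν) (uref : Finset (ℤ × ℤ × ℤ)) :
    (⋃ j ∈ uref, refCell s ν q R j) ∪ refRest s ν q R q₀ r_c uref = univ := by
  refine eq_univ_of_forall fun x => ?_
  have hx : x ∈ ⋃ u, voronoiCell (range (placedSite s ν q R)) (placedSite s ν q R u) := by
    rw [iUnion_voronoiCell_placedSite hs hν]; exact mem_univ x
  obtain ⟨u, hxu⟩ := mem_iUnion.1 hx
  by_cases hc : u ∈ collarCoreSites s ν q R q₀ r_c
  · exact mem_union_right _ (mem_union_left _ (mem_biUnion hc hxu))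
  by_cases hur : u ∈ uref
  · exact mem_union_left _ (mem_biUnion hur hxu)
  · refine mem_union_right _ (mem_union_right _ (mem_biUnion ?_ hxu))
    simp only [mem_compl_iff, mem_union, Finset.mem_coe, not_or]
    exact ⟨hc, hur⟩

/-- support: `refRest` is measurable. [«CollarWindow» `measurableSet_collarRefCore`] -/
theorem measurableSet_refRest (hs : IsHaggSeq s) (hν : 0 < ν) (uref : Finset (ℤ × ℤ × ℤ)) :
    MeasurableSet (refRest s ν q R q₀ r_c uref) :=
  (measurableSet_collarRefCore hs hν).union
    (MeasurableSet.biUnion (to_countable _) fun _ _ => (isClosed_voronoiCell _ _).measurableSet)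

/-- support (A.E.-DISJOINTNESS, reference side): reference sites off the core in `uref` ⇒ their cells are a.e.-disjoint from
`refRest` (distinct sites are distinct points). [«CellVoronoiFeed» `aedisjoint_voronoiCell`, «CollarSites»
`placedSite_injective`] -/
theorem aedisjoint_refRest (hs : IsHaggSeq s) (hν : 0 < ν) {uref : Finset (ℤ × ℤ × ℤ)}
    (huref : ∀ j ∈ uref, j ∉ collarCoreSites s ν q R q₀ r_c) :
    AEDisjoint volume (⋃ j ∈ uref, refCell s ν q R j) (refRest s ν q R q₀ r_c uref) := by
  have hinj := placedSite_injective (q := q) (R := R) hs hν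
  simp only [refRest, collarRefCore, refCell, AEDisjoint.iUnion_left_iff, AEDisjoint.union_right_iff,
    AEDisjoint.iUnion_right_iff]
  refine ⟨fun u hu j hj => ?_, fun u hu j hj => ?_⟩
  · exact aedisjoint_voronoiCell (mem_range_self j) (mem_range_self u) fun h => huref j hj (by rwa [hinj h])
  · refine aedisjoint_voronoiCell (mem_range_self j) (mem_range_self u) fun h => hu ?_
    rw [← hinj h]
    exact mem_union_right _ hj

/-- support: the reference halo carries no `g` ⇒ `∫_{refRest} g = ∫_{collarRefCore} g`. [Mathlib] -/
theorem integral_refRest_eq {uref : Finset (ℤ × ℤ × ℤ)} {g : EuclideanSpace ℝ (Fin 3) → ℝ}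
    (hg0 : ∀ u, u ∉ collarCoreSites s ν q R q₀ r_c → u ∉ uref → ∀ x ∈ refCell s ν q R u, g x = 0) :
    ∫ x in refRest s ν q R q₀ r_c uref, g x = ∫ x in collarRefCore s ν q R q₀ r_c, g x := by
  refine integral_union_eq_left_of_forall
    (MeasurableSet.biUnion (to_countable _) fun _ _ => (isClosed_voronoiCell _ _).measurableSet) fun x hx => ?_
  obtain ⟨u, hu, hxu⟩ := mem_iUnion₂.1 hx
  simp only [mem_compl_iff, mem_union, Finset.mem_coe, not_or] at hu
  exact hg0 u hu.1 hu.2 x hxu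

/-! ## §4 Why the halo carries no `g`: support in a ball, charted annulus, halo far -/

/-- support (COVERING RADIUS OF THE CHARTED ANNULUS): if every site with `ρ₁ < dist (p u) q₀ ≤ ρ₂` is charted and
`û`-registered, every point `x` with `ρ₁ + r₀ < dist x q₀`, `dist x q₀ + r₀ ≤ ρ₂` has an atom within `r₀ + û` (`r₀ = ν/√2`).
[«CollarSites» cover + circumradius] -/
theorem covering_of_charted (hs : IsHaggSeq s) (hν : 0 < ν) {r₀ û ρ₁ ρ₂ : ℝ} (hr₀ : r₀ = ν / Real.sqrt 2)
    (hch : ∀ u, ρ₁ < dist (placedSite s ν q R u) q₀ → dist (placedSite s ν q R u) q₀ ≤ ρ₂ →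
      u ∈ Ach ∧ dist (ych u) (placedSite s ν q R u) ≤ û)
    {x : EuclideanSpace ℝ (Fin 3)} (h1 : ρ₁ + r₀ < dist x q₀) (h2 : dist x q₀ + r₀ ≤ ρ₂) :
    ∃ z ∈ windowAtomSet Ach ych yunc, dist x z ≤ r₀ + û := by
  have hx : x ∈ ⋃ u, voronoiCell (range (placedSite s ν q R)) (placedSite s ν q R u) := by
    rw [iUnion_voronoiCell_placedSite hs hν]; exact mem_univ x
  obtain ⟨u, hxu⟩ := mem_iUnion.1 hx
  have hxr : dist x (placedSite s ν q R u) ≤ r₀ := by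
    rw [hr₀]; exact mem_closedBall.1 (voronoiCell_placedSite_subset_closedBall hs hν u hxu)
  have ht1 := dist_triangle x (placedSite s ν q R u) q₀
  have ht2 := dist_triangle (placedSite s ν q R u) x q₀
  rw [dist_comm (placedSite s ν q R u) x] at ht2
  obtain ⟨hu, hreg⟩ := hch u (by linarith) (by linarith)
  refine ⟨ych u, mem_union_left _ (mem_image_of_mem ych hu), ?_⟩
  have ht3 := dist_triangle x (placedSite s ν q R u) (ych u)
  rw [dist_comm (placedSite s ν q R u) (ych u)] at ht3
  linarith

/-- support (THE ACTUAL HALO CARRIES NO `g`): `supp g ⊆ closedBall q₀ ρg`; the annulus `ρ₁ < dist (p u) q₀ ≤ ρg + r₀` is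
charted and `û`-registered; one atom `z₀` lies within `R₀` of `q₀`; every charted non-core site off `t` has its atom at
distance `> ρg + r₀ + û` and `> 2(ρ₁ + r₀) + R₀` from `q₀` ⇒ `g` vanishes on its actual cell. [this file] -/
theorem halo_zero_act (hs : IsHaggSeq s) (hν : 0 < ν) {t : Finset (ℤ × ℤ × ℤ)} {g : EuclideanSpace ℝ (Fin 3) → ℝ}
    {r₀ û ρ₁ ρg R₀ : ℝ} (hr₀ : r₀ = ν / Real.sqrt 2) (hsupp : ∀ x, g x ≠ 0 → dist x q₀ ≤ ρg)
    (hch : ∀ u, ρ₁ < dist (placedSite s ν q R u) q₀ → dist (placedSite s ν q R u) q₀ ≤ ρg + r₀ →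
      u ∈ Ach ∧ dist (ych u) (placedSite s ν q R u) ≤ û)
    {z₀ : EuclideanSpace ℝ (Fin 3)} (hz₀ : z₀ ∈ windowAtomSet Ach ych yunc) (hR₀ : dist z₀ q₀ ≤ R₀)
    (hh1 : ∀ u ∈ Ach, u ∉ collarCoreSites s ν q R q₀ r_c → u ∉ t → ρg + r₀ + û < dist (ych u) q₀)
    (hh2 : ∀ u ∈ Ach, u ∉ collarCoreSites s ν q R q₀ r_c → u ∉ t → 2 * (ρ₁ + r₀) + R₀ < dist (ych u) q₀) :
    ∀ u ∈ Ach, u ∉ collarCoreSites s ν q R q₀ r_c → u ∉ t →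
      ∀ x ∈ voronoiCell (windowAtomSet Ach ych yunc) (ych u), g x = 0 := by
  intro u hu hc hut x hx
  by_contra hgx
  have hxg := hsupp x hgx
  have htri := dist_triangle (ych u) x q₀
  rw [dist_comm (ych u) x] at htri
  rcases lt_or_ge (ρ₁ + r₀) (dist x q₀) with hout | hin
  · obtain ⟨z, hz, hxz⟩ := covering_of_charted (yunc := yunc) hs hν hr₀ hch hout (by linarith)
    have h := hx z hz
    linarith [hh1 u hu hc hut]
  · have h := hx z₀ hz₀
    have ht0 := dist_triangle x q₀ z₀
    rw [dist_comm q₀ z₀] at ht0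
    linarith [hh2 u hu hc hut]

/-- support (THE REFERENCE HALO CARRIES NO `g`): `supp g ⊆ closedBall q₀ ρg` and `ρg + r₀ < dist (p u) q₀` for every non-core
site off `uref` ⇒ `g` vanishes on its reference cell (circumradius `r₀`). [«CollarSites»] -/
theorem halo_zero_ref (hs : IsHaggSeq s) (hν : 0 < ν) {uref : Finset (ℤ × ℤ × ℤ)} {g : EuclideanSpace ℝ (Fin 3) → ℝ}
    {r₀ ρg : ℝ} (hr₀ : r₀ = ν / Real.sqrt 2) (hsupp : ∀ x, g x ≠ 0 → dist x q₀ ≤ ρg)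
    (hh : ∀ u, u ∉ collarCoreSites s ν q R q₀ r_c → u ∉ uref → ρg + r₀ < dist (placedSite s ν q R u) q₀) :
    ∀ u, u ∉ collarCoreSites s ν q R q₀ r_c → u ∉ uref → ∀ x ∈ refCell s ν q R u, g x = 0 := by
  intro u hc hur x hx
  by_contra hgx
  have hxg := hsupp x hgx
  have hxr : dist x (placedSite s ν q R u) ≤ r₀ := by
    rw [hr₀]; exact mem_closedBall.1 (voronoiCell_placedSite_subset_closedBall hs hν u hx)
  have htri := dist_triangle (placedSite s ν q R u) x q₀
  rw [dist_comm (placedSite s ν q R u) x] at htri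
  linarith [hh u hc hur]

/-! ## §5 The eight tessellation facts of the ledger -/

/-- ★ support (THE TWO TESSELLATIONS OF THE WINDOW, in the binder shapes of «LedgerShells» `farField_ledger_of_shells` with
`Wr := univ`, `Uc₁ := moverRest … t`, `Uc₂ := refRest … uref`): finitely many atoms (`Ach` finite and non-empty, `μ` finite),
`ych` injective on `Ach`, movers = charted non-core sites with atoms off the uncharted ones, reference sites off the core,
`g` integrable. [this file] -/
theorem tiling_window [Finite μ] (hs : IsHaggSeq s) (hν : 0 < ν) (hA : Ach.Finite) (hne : Ach.Nonempty)
    (hinj : InjOn ych Ach) {t uref : Finset (ℤ × ℤ × ℤ)} (ht : ∀ u ∈ t, u ∈ Ach ∧ u ∉ collarCoreSites s ν q R q₀ r_c)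
    (hsep : ∀ u ∈ t, ∀ e, ych u ≠ yunc e) (huref : ∀ j ∈ uref, j ∉ collarCoreSites s ν q R q₀ r_c)
    {g : EuclideanSpace ℝ (Fin 3) → ℝ} (hgi : Integrable g) :
    AEDisjoint volume (⋃ i ∈ t, voronoiCell (windowAtomSet Ach ych yunc) (ych i)) (moverRest s ν q R Ach ych yunc q₀ r_c t) ∧
      NullMeasurableSet (moverRest s ν q R Ach ych yunc q₀ r_c t) volume ∧
      (((⋃ i ∈ t, voronoiCell (windowAtomSet Ach ych yunc) (ych i)) ∪ moverRest s ν q R Ach ych yunc q₀ r_c t :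
          Set (EuclideanSpace ℝ (Fin 3))) =ᵐ[volume] (univ : Set (EuclideanSpace ℝ (Fin 3)))) ∧
      IntegrableOn g (moverRest s ν q R Ach ych yunc q₀ r_c t) ∧
      AEDisjoint volume (⋃ j ∈ uref, refCell s ν q R j) (refRest s ν q R q₀ r_c uref) ∧
      NullMeasurableSet (refRest s ν q R q₀ r_c uref) volume ∧
      (((⋃ j ∈ uref, refCell s ν q R j) ∪ refRest s ν q R q₀ r_c uref : Set (EuclideanSpace ℝ (Fin 3)))
          =ᵐ[volume] (univ : Set (EuclideanSpace ℝ (Fin 3)))) ∧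
      IntegrableOn g (refRest s ν q R q₀ r_c uref) :=
  ⟨aedisjoint_moverRest hinj ht hsep, (measurableSet_moverRest hA t).nullMeasurableSet,
    by rw [cover_moverRest (s := s) (ν := ν) (q := q) (R := R) (ych := ych) (yunc := yunc) (q₀ := q₀) (r_c := r_c) hA hne t],
    hgi.integrableOn, aedisjoint_refRest hs hν huref, (measurableSet_refRest hs hν uref).nullMeasurableSet,
    by rw [cover_refRest (q := q) (R := R) (q₀ := q₀) (r_c := r_c) hs hν uref], hgi.integrableOn⟩

end Facts

end

end Summit.AtomisticToContinuum.Crystallization.Theorems.OverbindingBudgetAffineFarFieldLedgerTiling
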